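import Summits.QuantumFields.YangMills.Theorems.BalabanUVNodesN17AtRecord11
import Literature.MathematicalPhysics.QuantumFieldTheory.Balaban1983to89.Node00.Record11DatumKey
import Literature.MathematicalPhysics.QuantumFieldTheory.Balaban1983to89.Node00.RateRecord11

/-!
# BalabanUVNodes ∕ node N17 = NE4 AT THE KEYS OF RECORD OF STAGE 11: the canonical datum key `Node00.IsDatumOfRecord₁₁C` ∕ `.params` (RR-2, the key of record
# of the rate-record home, dag-lead WORDS-101 (ii)), the θ-exposed world-bound key `Node00.IsRateKey₁₁` (RR-1 layer A), the LEVEL BUNDLES of layer A's U3 objects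
# `Node00.U3Objects₁₁` (what layer B's `u3OfRecord₁₁ θ u k` unfolds to), and the KEYED U3 GLUE «(D4) ∧ NE5 ⇒ NE4» at the Stage-11 tuples (n27-c XXII's `h17`)

Cell `pub-ymgap`, HUMAN RULING D-0062, seat `pub-ymgap-dag-n17-c` gen 2 (lane s2; dag-lead TABLE v23 row n17 «U3 road waits RR layer A p455395 ✓ → consumer re-key»;
WORDS-101: import order `Record11` → `Record11DatumKey` → `RateRecord11` layer A → {layer B `RRec₁₁`, (T-SPINE)} → consumers (n17 …)), companion 11 (§37–§40) of the
N17 lineage.  THEOREMS ONLY; imports companion 9 `…N17AtRecord11` (p450153), RR-2's `Node00/Record11DatumKey` (p455304: `IsDatumOfRecord₁₁C`, `.params ∕ .provisos ∕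
.admissible ∕ .eq_datumOfRecord₁₁ ∕ .βfun_eq_betaOfRecord₁₁`, def-B's names underneath) and RR-1's layer A `Node00/RateRecord11` (p455395: `IsRateKey₁₁` with
`.exists_provisos ∕ .gamma_le ∕ .gamma_pos`, `U3Objects₁₁ ⊇ U3Letters₁₁`).  It deliberately imports NEITHER layer B (`…RateCarriersOfRecord11`, n22-e, definition lane)
NOR n27-c's XXII: every statement below is about the literal terms those files key ∕ quantify, so their one-application faces (`s_N17_rRec₁₁_iff`,
`spine_rec11C_of_keyed₁₁_six`'s `h17`) are ONE `exact` ∕ `Iff.rfl` away — nothing of theirs re-typed, no import cycle possible.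

WHY.  N17 reads a datum ONLY through `D.βfun` (companion 6 `n17At_congr_βfun`), and both keys of record PIN the Stage-11 parameter behind the datum:
`h : IsDatumOfRecord₁₁C F N D` carries `D.βfun = betaOfRecord₁₁ F N h.params` (RR-2), `hk : IsRateKey₁₁ F N D w θ` carries `D = datumOfRecord₁₁ F N θ hP` with
`w.γ ≤ θ.γ` (RR-1).  So AT A KEY node N17 is an `iff` — `NE4OnData D c ρ γ' ↔ ScaleShiftRate c ρ γ' (betaMergedOfRecord₁₁ F N θ)` on boxes inside the record box — where
companion 9's ₁₁C ∀-form (`N17_of_isRecordOfRecord₁₁C`) was one-way (the record predicate hides θ).  Layer B keys the U3 bundle of a record as LEVEL `k` of ONE object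
tower `u : U3Objects₁₁` read at `h.params` with window `Window θ.γ` (n22-e INTENT-2 (T-RATE), l.12600: `u3OfRecord₁₁ θ u k := ⟨u.levelCarriers k, Window θ.γ, θ.γ, u.κ,
u.EA k, u.EB k, u.θ₅, u.C₅, u.moduli, u.C₉, u.ω, u.cr, u.ρ⟩`); N17 at that bundle is `NE4OnData D (u.cr·u.C₅·u.θ₅) u.ρ θ.γ` — LEVEL-FREE (the letters are K-uniform by
TYPE) and CARRIER-FREE (N17 never reads `levelCarriers ∕ EA ∕ EB`): §39.
* §37 AT THE CANONICAL DATUM KEY: `N17_iff_betaOfRecord₁₁_params` (every box side), `N17_iff_betaMergedOfRecord₁₁_params` (`γ' ≤ h.params.γ`), `n17At_iff_params`,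
  `u2Inputs_iff_params`, `N17_params_of_split₁₁` (the split road at `oneLoopSplitOfRecord₁₁ h.params`), `af0r_params_of_N17` (what N17 delivers: (AF-0r) for
  `beta0OfRecord₁₁ h.params`).
* §38 AT THE θ-EXPOSED KEY: `N17_iff_of_isRateKey₁₁` (the world's window), `N17_iff_of_isRateKey₁₁_of_le`, `n17At_iff_of_isRateKey₁₁`, `N17_of_isRateKey₁₁_of_split₁₁`,
  `af0r_of_N17_isRateKey₁₁` (conclusion about THE key's θ — no `∃ θ`).
* §39 AT LAYER A's LEVEL BUNDLES AND THE HOME SHAPES: `n17At_u3Level₁₁_iff` (`Iff.rfl`, level- and carrier-free), `n17At_u3Level₁₁_iff_params`,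
  **`s_N17_towerKeyed₁₁_iff`** (`S_N17` at ANY rate-record predicate of layer B's literal shape «`∃ (h : IsDatumOfRecord₁₁C F N D) (k : ℕ), R = rc F h.params g₀ os k`»
  ⟺ the `betaOfRecord₁₁ h.params` rate at the reading's U3 letters, every datum key, every `g₀, os, k`), `s_N17_towerKeyed₁₁_of_merged`, **`s_N17_of_datumKeyed₁₁`**
  (one-application closer for any `RRec` whose bundles come with a datum key, `R.u3.γ ≤ h.params.γ` and the merged-β rate), `s_N17_of_rateKeyed₁₁` (the same over
  `IsRateKey₁₁` with `R.u3.γ = w.γ`).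
* §40 THE KEYED U3 GLUE «(D4) ∧ NE5 ⇒ NE4» (N22 idle — companion `…N17AtSpineCarriers`' `YMDAG.N17.n17At_of_readOutAt`): `n17_keyed₁₁_of_readOut_keyed` (n27-c XXII's
  `h17` from `hD4 ∕ h18` keyed at `(θ, hP)`), `ratesAt_keyed₁₁_of_five_glueN17` (XXII's `hrates` from the FIVE keyed rate stubs + keyed (D4)), `n17_towerKeyed₁₁_of_readOut`
  (the same at layer B's key).
NO INHABITANT of any key is claimed (K0 = stmt-QuantumFields-19673); nothing needs a junk guard (every statement is an implication ∕ `iff` at a given key).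

HONEST FRAMING.  Kernel bookkeeping BY NAME; 0 sorry, 0 def; NE4 NOT IN PRINT ([Balaban1987RG1] p. 264) and NOT PROVED; every rate ∕ (AF-0r) ∕ `RemainderShiftRate` ∕
(D4) ∕ NE5 input is a DISPLAYED hypothesis (rows NE2 ∕ NE3 ∕ NE5 ∕ (D4) = N15 ∕ N16 ∕ N18 ∕ NODE O); the readings `rc ∕ rr` are PARAMETERS (the objects of record are
RESIDUAL in layer A — a skeleton quoting `S_N17 (RRec₁₁ 𝔯)` NAMES its `𝔯`); N17 NOT discharged; «A: n∕28» unmoved.  One finite four-torus at fixed ε per run — NOT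
infinite volume, NOT OS on ℝ⁴, NOT a mass gap, NOT Clay.
-/

noncomputable section

open scoped Matrix.Norms.L2Operator

namespace Summit.QuantumFields.YangMills.Theorems.BalabanUVNodesN17

open Filter Topology
open Literature.MathematicalPhysics.QuantumFieldTheory.Balaban1983to89
open Literature.MathematicalPhysics.QuantumFieldTheory.Balaban1983to89.FlowStep
open Literature.MathematicalPhysics.QuantumFieldTheory.Balaban1983to89.T4CouplingMatching
open Literature.MathematicalPhysics.QuantumFieldTheory.Balaban1983to89.T4Continuum (T4Family FiniteEpsData ULoop)
open Literature.MathematicalPhysics.QuantumFieldTheory.Balaban1983to89.T4OutputRate (Window)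
open Literature.MathematicalPhysics.QuantumFieldTheory.Balaban1983to89.Node00
open Literature.MathematicalPhysics.QuantumFieldTheory.Balaban1983to89.DagBinding (WorldP)
open Summit.QuantumFields.BalabanUV.T4Continuum.Spine.NE4 (NE4OnData U2Inputs ne4OnData_iff)
open YMDAG.UVSplit (Datum U3Carriers RateCarriers RateRecordPred N17At N14At N15At N16At N18At N22At ReadOutAt RatesAt S_N17)

variable {F : T4Family} {N : ℕ} [NeZero N]

/-! ## §37 N17 AT THE CANONICAL DATUM KEY `IsDatumOfRecord₁₁C F N D` (RR-2): the datum's β IS `betaOfRecord₁₁ h.params` -/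

/-- **N17 AT A DATUM OF RECORD IS THE SCALE-SHIFT RATE OF `betaOfRecord₁₁ h.params`** — every box side (`h.βfun_eq_betaOfRecord₁₁`). [cite: Balaban1987RG1, (1.20)-(1.22) p.264] -/
theorem N17_iff_betaOfRecord₁₁_params {D : Datum F N} (h : IsDatumOfRecord₁₁C F N D) (c ρ γ' : ℝ) :
    NE4OnData D c ρ γ' ↔ ScaleShiftRate c ρ γ' (betaOfRecord₁₁ F N h.params) := by
  rw [ne4OnData_iff, h.βfun_eq_betaOfRecord₁₁]

/-- **… AND, ON BOXES INSIDE THE CANONICAL RECORD BOX (`γ' ≤ h.params.γ`), OF THE MERGED β `betaMergedOfRecord₁₁ h.params`** (companion 4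
`scaleShiftRate_betaOfMerged_iff`; def-B `betaOfRecord₁₁_eq_betaOfMerged`, `rfl`). [cite: Balaban1987RG1, (1.22) p.264 and (2.12)-(2.14) p.268] -/
theorem N17_iff_betaMergedOfRecord₁₁_params {D : Datum F N} (h : IsDatumOfRecord₁₁C F N D) {c ρ γ' : ℝ} (hγ : γ' ≤ h.params.γ) :
    NE4OnData D c ρ γ' ↔ ScaleShiftRate c ρ γ' (betaMergedOfRecord₁₁ F N h.params) :=
  (N17_iff_betaOfRecord₁₁_params h c ρ γ').trans
    (scaleShiftRate_betaOfMerged_iff (βm := betaMergedOfRecord₁₁ F N h.params) (β0 := beta0OfRecord₁₁ F N h.params) hγ)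

/-- **… IN CLUSTER K4's LETTERS**: for node U3's carriers `u` with `u.γ ≤ h.params.γ`, `N17At D u ↔ ScaleShiftRate (u.cr·u.C₅·u.θ) u.ρ u.γ (betaMergedOfRecord₁₁ h.params)`.
[cite: Balaban1987RG1, (1.20)-(1.22) p.264] -/
theorem n17At_iff_params {D : Datum F N} (h : IsDatumOfRecord₁₁C F N D) (u : U3Carriers) (hγ : u.γ ≤ h.params.γ) :
    N17At D u ↔ ScaleShiftRate (u.cr * u.C₅ * u.θ) u.ρ u.γ (betaMergedOfRecord₁₁ F N h.params) :=
  N17_iff_betaMergedOfRecord₁₁_params h hγ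

/-- K4's letters, every box side: `N17At D u ↔ ScaleShiftRate (u.cr·u.C₅·u.θ) u.ρ u.γ (betaOfRecord₁₁ h.params)`. [cite: Balaban1987RG1, (1.20)-(1.22) p.264] -/
theorem n17At_iff_betaOfRecord₁₁_params {D : Datum F N} (h : IsDatumOfRecord₁₁C F N D) (u : U3Carriers) :
    N17At D u ↔ ScaleShiftRate (u.cr * u.C₅ * u.θ) u.ρ u.γ (betaOfRecord₁₁ F N h.params) :=
  N17_iff_betaOfRecord₁₁_params h _ _ _

/-- **NODE U2's INPUT TRIPLE AT A DATUM OF RECORD** (box `γ' ≤ h.params.γ`): the `betaMergedOfRecord₁₁ h.params` rate ∧ its history moduli ∧ fading memory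
(companion 4 `histLipschitz_betaOfMerged_iff` for the moduli). [cite: Balaban1987RG1, §5 p.298] -/
theorem u2Inputs_iff_params {D : Datum F N} (h : IsDatumOfRecord₁₁C F N D) {c C ρ γ' : ℝ} {Λ : ℕ → ℕ → ℝ} (hγ : γ' ≤ h.params.γ) :
    U2Inputs D c C ρ γ' Λ ↔
      ScaleShiftRate c ρ γ' (betaMergedOfRecord₁₁ F N h.params) ∧ HistLipschitz Λ γ' (betaMergedOfRecord₁₁ F N h.params) ∧ FadingMemory C ρ Λ := by
  unfold U2Inputs
  rw [h.βfun_eq_betaOfRecord₁₁]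
  exact and_congr (scaleShiftRate_betaOfMerged_iff (βm := betaMergedOfRecord₁₁ F N h.params) (β0 := beta0OfRecord₁₁ F N h.params) hγ)
    (and_congr (histLipschitz_betaOfMerged_iff (βm := betaMergedOfRecord₁₁ F N h.params) (β0 := beta0OfRecord₁₁ F N h.params) hγ) Iff.rfl)

/-- **THE SPLIT ROAD AT A DATUM OF RECORD**: (AF-0r) for the one-loop numbers `beta0OfRecord₁₁ h.params` (N15 ∕ NODE O currency) ∧
`RemainderShiftRate (oneLoopSplitOfRecord₁₁ h.params) c₁ ρ γ'` (N16 ∕ N18), `0 ≤ ρ ≤ 1`, `0 ≤ c₀` ⟹ `NE4OnData D (2c₀ + c₁) ρ γ'`, every box side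
(`T4CouplingMatching.scaleShiftRate_of_split` at the split of record). [cite: Balaban1987RG1, (2.12)-(2.14) p.268] -/
theorem N17_params_of_split₁₁ {D : Datum F N} (h : IsDatumOfRecord₁₁C F N D) {binf c₀ c₁ ρ γ' : ℝ} (hρ0 : 0 ≤ ρ) (hρ1 : ρ ≤ 1) (hc₀ : 0 ≤ c₀)
    (hconv : ∀ k, |beta0OfRecord₁₁ F N h.params k - binf| ≤ c₀ * ρ ^ k)
    (hrem : RemainderShiftRate (oneLoopSplitOfRecord₁₁ F N h.params) c₁ ρ γ') : NE4OnData D (2 * c₀ + c₁) ρ γ' :=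
  (N17_iff_betaOfRecord₁₁_params h _ _ _).mpr (scaleShiftRate_of_split (oneLoopSplitOfRecord₁₁ F N h.params) hρ0 hρ1 hc₀ hconv hrem)

/-- **WHAT N17 DELIVERS AT A DATUM OF RECORD**: on a box side `0 < γ' ≤ h.params.γ` with `ρ < 1`, if `Beta0LimitExists (betaMergedOfRecord₁₁ h.params) h.params.v₀` holds at
COHERENT reference histories with entries in `]0,γ']`, then `NE4OnData D c ρ γ'` gives (AF-0r) `∃ β⁰_∞, |beta0OfRecord₁₁ h.params k − β⁰_∞| ≤ (c∕(1−ρ))ρ^k`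
(companion 4 `af0r_beta0OfMerged_of_scaleShiftRate`). [cite: Balaban1987RG1, (2.12)-(2.14) p.268] -/
theorem af0r_params_of_N17 {D : Datum F N} (h : IsDatumOfRecord₁₁C F N D) {c ρ γ' : ℝ} (hγ : γ' ≤ h.params.γ) (hγ' : 0 < γ') (hρ1 : ρ < 1)
    (hlim : Beta0LimitExists (betaMergedOfRecord₁₁ F N h.params) h.params.v₀) (hcoh : ∀ k, Fin.tail (h.params.v₀ (k + 1)) = h.params.v₀ k)
    (hadm : ∀ k i, 0 < h.params.v₀ k i ∧ h.params.v₀ k i ≤ γ') (hN17 : NE4OnData D c ρ γ') :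
    ∃ binf : ℝ, ∀ k, |beta0OfRecord₁₁ F N h.params k - binf| ≤ c / (1 - ρ) * ρ ^ k :=
  af0r_beta0OfMerged_of_scaleShiftRate hlim hcoh hadm hγ' hρ1 ((N17_iff_betaMergedOfRecord₁₁_params h hγ).mp hN17)

/-! ## §38 N17 AT THE θ-EXPOSED WORLD-BOUND KEY `IsRateKey₁₁ F N D w θ` (RR-1 layer A): an `iff` about THAT θ -/

/-- **N17 AT A KEYED RECORD, ON THE WORLD's WINDOW, IS THE SCALE-SHIFT RATE OF THE KEY's MERGED β**: `IsRateKey₁₁ F N D w θ ⊢ NE4OnData D c ρ w.γ ↔ ScaleShiftRate c ρ w.γ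
(betaMergedOfRecord₁₁ θ)` (the key realises `D = datumOfRecord₁₁ θ hP` with `w.γ ≤ θ.γ`; companion 9 `N17_datumOfRecord₁₁_iff_merged`).  The ₁₁C ∀-form of companion 9 is the
`mpr` direction quantified over presentations. [cite: Balaban1987RG1, (1.20)-(1.22) p.264; Balaban1989LargeFieldII, Thm 1 p.355] -/
theorem N17_iff_of_isRateKey₁₁ {D : Datum F N} {w : WorldP} {θ : Stage11Params F N} (hk : IsRateKey₁₁ F N D w θ) (c ρ : ℝ) :
    NE4OnData D c ρ w.γ ↔ ScaleShiftRate c ρ w.γ (betaMergedOfRecord₁₁ F N θ) := by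
  obtain ⟨hP, -, hD⟩ := hk.exists_provisos
  have hγ := hk.gamma_le
  subst hD
  exact N17_datumOfRecord₁₁_iff_merged θ hP hγ

/-- … on ANY box inside the key's record box (`γ' ≤ θ.γ`). [cite: Balaban1987RG1, (1.20)-(1.22) p.264] -/
theorem N17_iff_of_isRateKey₁₁_of_le {D : Datum F N} {w : WorldP} {θ : Stage11Params F N} (hk : IsRateKey₁₁ F N D w θ) {c ρ γ' : ℝ}
    (hγ : γ' ≤ θ.γ) : NE4OnData D c ρ γ' ↔ ScaleShiftRate c ρ γ' (betaMergedOfRecord₁₁ F N θ) := by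
  obtain ⟨hP, -, hD⟩ := hk.exists_provisos
  subst hD
  exact N17_datumOfRecord₁₁_iff_merged θ hP hγ

/-- … in K4's letters, for node U3's carriers with `u.γ ≤ θ.γ`. [cite: Balaban1987RG1, (1.20)-(1.22) p.264] -/
theorem n17At_iff_of_isRateKey₁₁ {D : Datum F N} {w : WorldP} {θ : Stage11Params F N} (hk : IsRateKey₁₁ F N D w θ) (u : U3Carriers)
    (hγ : u.γ ≤ θ.γ) : N17At D u ↔ ScaleShiftRate (u.cr * u.C₅ * u.θ) u.ρ u.γ (betaMergedOfRecord₁₁ F N θ) :=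
  N17_iff_of_isRateKey₁₁_of_le hk hγ

/-- **THE SPLIT ROAD AT A KEYED RECORD** on the world's window: (AF-0r)(`beta0OfRecord₁₁ θ`) ∧ `RemainderShiftRate (oneLoopSplitOfRecord₁₁ θ) c₁ ρ w.γ`, `0 ≤ ρ ≤ 1`,
`0 ≤ c₀` ⟹ `NE4OnData D (2c₀ + c₁) ρ w.γ`. [cite: Balaban1987RG1, (2.12)-(2.14) p.268] -/
theorem N17_of_isRateKey₁₁_of_split₁₁ {D : Datum F N} {w : WorldP} {θ : Stage11Params F N} (hk : IsRateKey₁₁ F N D w θ) {binf c₀ c₁ ρ : ℝ}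
    (hρ0 : 0 ≤ ρ) (hρ1 : ρ ≤ 1) (hc₀ : 0 ≤ c₀) (hconv : ∀ k, |beta0OfRecord₁₁ F N θ k - binf| ≤ c₀ * ρ ^ k)
    (hrem : RemainderShiftRate (oneLoopSplitOfRecord₁₁ F N θ) c₁ ρ w.γ) : NE4OnData D (2 * c₀ + c₁) ρ w.γ := by
  obtain ⟨hP, -, hD⟩ := hk.exists_provisos
  subst hD
  exact scaleShiftRate_of_split (oneLoopSplitOfRecord₁₁ F N θ) hρ0 hρ1 hc₀ hconv hrem

/-- **WHAT N17 DELIVERS AT A KEYED RECORD — ABOUT THE KEY's OWN θ** (no `∃ θ`, contrast companion 9 `af0r_of_N17_isRecordOfRecord₁₁C`): `NE4OnData D c ρ w.γ` with `ρ < 1`,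
`Beta0LimitExists (betaMergedOfRecord₁₁ θ) θ.v₀` at coherent reference histories with entries in `]0, w.γ]` ⟹ `∃ β⁰_∞, |beta0OfRecord₁₁ θ k − β⁰_∞| ≤ (c∕(1−ρ))ρ^k`
(`0 < w.γ` is the key's clause). [cite: Balaban1987RG1, (2.12)-(2.14) p.268] -/
theorem af0r_of_N17_isRateKey₁₁ {D : Datum F N} {w : WorldP} {θ : Stage11Params F N} (hk : IsRateKey₁₁ F N D w θ) {c ρ : ℝ} (hρ1 : ρ < 1)
    (hlim : Beta0LimitExists (betaMergedOfRecord₁₁ F N θ) θ.v₀) (hcoh : ∀ k, Fin.tail (θ.v₀ (k + 1)) = θ.v₀ k)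
    (hadm : ∀ k i, 0 < θ.v₀ k i ∧ θ.v₀ k i ≤ w.γ) (hN17 : NE4OnData D c ρ w.γ) :
    ∃ binf : ℝ, ∀ k, |beta0OfRecord₁₁ F N θ k - binf| ≤ c / (1 - ρ) * ρ ^ k :=
  af0r_beta0OfMerged_of_scaleShiftRate hlim hcoh hadm hk.gamma_pos hρ1 ((N17_iff_of_isRateKey₁₁ hk c ρ).mp hN17)

/-! ## §39 N17 AT LAYER A's LEVEL BUNDLES `⟨u.levelCarriers k, Window γ, γ, u.κ, u.EA k, u.EB k, u.θ₅, u.C₅, u.moduli, u.C₉, u.ω, u.cr, u.ρ⟩` AND THE HOME SHAPES -/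

/-- **N17 AT THE LEVEL-`k` BUNDLE OF THE RECORD's U3 OBJECTS IS ONE STATEMENT, LEVEL-FREE AND CARRIER-FREE** (`Iff.rfl`): for `u : Node00.U3Objects₁₁` and a window
radius `γ`, N17 at the literal bundle layer B's `u3OfRecord₁₁` builds (n22-e (T-RATE): `Window θ.γ`, `θ.γ`) is `NE4OnData D (u.cr·u.C₅·u.θ₅) u.ρ γ` — the letters are
K-uniform BY TYPE (`U3Letters₁₁`) and N17 never reads `levelCarriers ∕ EA ∕ EB`. [cite: Balaban1987RG1, (1.20)-(1.22) p.264] -/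
theorem n17At_u3Level₁₁_iff (D : Datum F N) (u : U3Objects₁₁) (γ : ℝ) (k : ℕ) :
    N17At D ⟨u.levelCarriers k, Window γ, γ, u.κ, u.EA k, u.EB k, u.θ₅, u.C₅, u.moduli, u.C₉, u.ω, u.cr, u.ρ⟩ ↔
      NE4OnData D (u.cr * u.C₅ * u.θ₅) u.ρ γ := Iff.rfl

/-- **… AT A DATUM OF RECORD, window inside the canonical record box (`γ ≤ h.params.γ`; layer B takes `γ := h.params.γ`)**: ⟺ the merged-β rate
`ScaleShiftRate (u.cr·u.C₅·u.θ₅) u.ρ γ (betaMergedOfRecord₁₁ h.params)`. [cite: Balaban1987RG1, (1.20)-(1.22) p.264] -/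
theorem n17At_u3Level₁₁_iff_params {D : Datum F N} (h : IsDatumOfRecord₁₁C F N D) (u : U3Objects₁₁) {γ : ℝ} (hγ : γ ≤ h.params.γ) (k : ℕ) :
    N17At D ⟨u.levelCarriers k, Window γ, γ, u.κ, u.EA k, u.EB k, u.θ₅, u.C₅, u.moduli, u.C₉, u.ω, u.cr, u.ρ⟩ ↔
      ScaleShiftRate (u.cr * u.C₅ * u.θ₅) u.ρ γ (betaMergedOfRecord₁₁ F N h.params) :=
  N17_iff_betaMergedOfRecord₁₁_params h hγ

section HomeShapes

variable (rc : (F : T4Family) → Stage11Params F N → (ℕ → ℝ) → List (ULoop F) → ℕ → RateCarriers N)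

/-- **`S_N17` AT A TOWER-KEYED RATE RECORD OF LAYER B's LITERAL SHAPE** «`RRec F D g₀ os R :↔ ∃ (h : IsDatumOfRecord₁₁C F N D) (k : ℕ), R = rc F h.params g₀ os k`» (n22-e's
`RRec₁₁ 𝔯` is this with `rc := rateCarriersOfRecord₁₁ 𝔯`) ⟺ «at every datum of record, every `g₀, os`, every run length `k`: the scale-shift rate of
`betaOfRecord₁₁ h.params` at the reading's U3 letters» — every box side, no window hypothesis.  The reading `rc` is a PARAMETER. [cite: Balaban1987RG1, (1.20)-(1.22) p.264] -/
theorem s_N17_towerKeyed₁₁_iff :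
    S_N17 (fun F (D : Datum F N) g₀ os R => ∃ (h : IsDatumOfRecord₁₁C F N D) (k : ℕ), R = rc F h.params g₀ os k) ↔
      ∀ (F : T4Family) (D : Datum F N) (h : IsDatumOfRecord₁₁C F N D) (g₀ : ℕ → ℝ) (os : List (ULoop F)) (k : ℕ),
        ScaleShiftRate ((rc F h.params g₀ os k).u3.cr * (rc F h.params g₀ os k).u3.C₅ * (rc F h.params g₀ os k).u3.θ)
          (rc F h.params g₀ os k).u3.ρ (rc F h.params g₀ os k).u3.γ (betaOfRecord₁₁ F N h.params) := by
  constructor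
  · intro hS F D h g₀ os k
    exact (n17At_iff_betaOfRecord₁₁_params h _).mp (hS F D g₀ os _ ⟨h, k, rfl⟩)
  · rintro hin F D g₀ os R ⟨h, k, rfl⟩
    exact (n17At_iff_betaOfRecord₁₁_params h _).mpr (hin F D h g₀ os k)

/-- **… FROM THE MERGED-β RATE** when the reading's window sits inside the canonical record box (`(rc …).u3.γ ≤ h.params.γ`, e.g. layer B's `u3.γ = θ.γ`):
the `betaMergedOfRecord₁₁ h.params` rate at the letters, for every datum key, `g₀, os, k` ⟹ `S_N17` there. [cite: Balaban1987RG1, (1.20)-(1.22) p.264] -/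
theorem s_N17_towerKeyed₁₁_of_merged
    (hin : ∀ (F : T4Family) (D : Datum F N) (h : IsDatumOfRecord₁₁C F N D) (g₀ : ℕ → ℝ) (os : List (ULoop F)) (k : ℕ),
      (rc F h.params g₀ os k).u3.γ ≤ h.params.γ ∧
        ScaleShiftRate ((rc F h.params g₀ os k).u3.cr * (rc F h.params g₀ os k).u3.C₅ * (rc F h.params g₀ os k).u3.θ)
          (rc F h.params g₀ os k).u3.ρ (rc F h.params g₀ os k).u3.γ (betaMergedOfRecord₁₁ F N h.params)) :
    S_N17 (fun F (D : Datum F N) g₀ os R => ∃ (h : IsDatumOfRecord₁₁C F N D) (k : ℕ), R = rc F h.params g₀ os k) := by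
  rintro F D g₀ os R ⟨h, k, rfl⟩
  obtain ⟨hγ, hm⟩ := hin F D h g₀ os k
  exact (n17At_iff_params h _ hγ).mpr hm

end HomeShapes

/-- **(W2) CLOSER FOR ANY `RRec` WHOSE BUNDLES COME WITH A DATUM KEY** (refinement-generic): if every bundle `R` of record for `(F, D, g₀, os)` comes with
`h : IsDatumOfRecord₁₁C F N D`, `R.u3.γ ≤ h.params.γ` and the `betaMergedOfRecord₁₁ h.params` rate at `R.u3`'s letters, then `S_N17 RRec` — ONE application at layer B
(`RRec₁₁.datumKey` + the estimate). [cite: Balaban1987RG1, (1.20)-(1.22) p.264] -/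
theorem s_N17_of_datumKeyed₁₁ (RRec : RateRecordPred N)
    (hkey : ∀ (F : T4Family) (D : Datum F N) (g₀ : ℕ → ℝ) (os : List (ULoop F)) (R : RateCarriers N), RRec F D g₀ os R →
      ∃ h : IsDatumOfRecord₁₁C F N D, R.u3.γ ≤ h.params.γ ∧
        ScaleShiftRate (R.u3.cr * R.u3.C₅ * R.u3.θ) R.u3.ρ R.u3.γ (betaMergedOfRecord₁₁ F N h.params)) :
    S_N17 RRec := by
  intro F D g₀ os R hR
  obtain ⟨h, hγ, hm⟩ := hkey F D g₀ os R hR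
  exact (n17At_iff_params h R.u3 hγ).mpr hm

/-- **(W2) CLOSER FOR ANY `RRec` WHOSE BUNDLES COME WITH A θ-EXPOSED KEY** whose world window IS node U3's box (`R.u3.γ = w.γ`) and the `betaMergedOfRecord₁₁ θ` rate
at `R.u3`'s letters ⟹ `S_N17 RRec` (RR-1's world-bound road; companion 9 `s_N17_of_rec₁₁C` without the ∀ θ). [cite: Balaban1987RG1, (1.20)-(1.22) p.264] -/
theorem s_N17_of_rateKeyed₁₁ (RRec : RateRecordPred N)
    (hkey : ∀ (F : T4Family) (D : Datum F N) (g₀ : ℕ → ℝ) (os : List (ULoop F)) (R : RateCarriers N), RRec F D g₀ os R →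
      ∃ (θ : Stage11Params F N) (w : WorldP), IsRateKey₁₁ F N D w θ ∧ R.u3.γ = w.γ ∧
        ScaleShiftRate (R.u3.cr * R.u3.C₅ * R.u3.θ) R.u3.ρ R.u3.γ (betaMergedOfRecord₁₁ F N θ)) :
    S_N17 RRec := by
  intro F D g₀ os R hR
  obtain ⟨θ, w, hk, hγ, hm⟩ := hkey F D g₀ os R hR
  exact (n17At_iff_of_isRateKey₁₁ hk R.u3 (hγ.le.trans hk.gamma_le)).mpr hm

/-! ## §40 THE KEYED U3 GLUE «(D4) ∧ NE5 ⇒ NE4» AT THE STAGE-11 TUPLES (N22 idle: `YMDAG.N17.n17At_of_readOutAt`) -/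

section KeyedGlue

variable (rr : (F : T4Family) → (θ : Stage11Params F N) → θ.Provisos₁₁ → (ℕ → ℝ) → List (ULoop F) → RateCarriers N)

/-- **n27-c XXII's `h17` FROM THE KEYED (D4) AND NE5 STUBS**: for a rate reading `rr` off the Stage-11 tuples, the (D4) read-out binders at
`(datumOfRecord₁₁ θ hP, (rr F θ hP g₀ os).u3)` and NE5 at `(rr F θ hP g₀ os).u3`, for every admissible `θ` with provisos, every `g₀, os` ⟹ XXII's keyed N17 stub
`∀ F θ hP, θ.Admissible → ∀ g₀ os, N17At (datumOfRecord₁₁ F N θ hP) (rr F θ hP g₀ os).u3` — pointwise `YMDAG.N17.n17At_of_readOutAt` (the U3 → U2 edge, N22 idle).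
(D4) and NE5 UNPRINTED — binders. [cite: Balaban1987RG1, (1.20)-(1.22) p.264] -/
theorem n17_keyed₁₁_of_readOut_keyed
    (hD4 : ∀ (F : T4Family) (θ : Stage11Params F N) (hP : θ.Provisos₁₁), θ.Admissible → ∀ (g₀ : ℕ → ℝ) (os : List (ULoop F)),
      ReadOutAt (datumOfRecord₁₁ F N θ hP) (rr F θ hP g₀ os).u3)
    (h18 : ∀ (F : T4Family) (θ : Stage11Params F N) (hP : θ.Provisos₁₁), θ.Admissible → ∀ (g₀ : ℕ → ℝ) (os : List (ULoop F)),
      N18At (rr F θ hP g₀ os).u3)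
    (F : T4Family) (θ : Stage11Params F N) (hP : θ.Provisos₁₁) (hθ : θ.Admissible) (g₀ : ℕ → ℝ) (os : List (ULoop F)) :
    N17At (datumOfRecord₁₁ F N θ hP) (rr F θ hP g₀ os).u3 :=
  YMDAG.N17.n17At_of_readOutAt _ (hD4 F θ hP hθ g₀ os) (h18 F θ hP hθ g₀ os)

/-- **XXII's `hrates` FROM THE FIVE KEYED RATE STUBS AND THE KEYED (D4)** (N17 GLUED, not assumed): N14 NE1′ · N15 NE2 · N16 NE3 · N18 NE5 · N22 NE9 + fading memory at
`rr F θ hP g₀ os` and the (D4) read-out on the datum of record ⟹ `RatesAt (datumOfRecord₁₁ θ hP) (rr F θ hP g₀ os)` for every admissible `θ` with provisos, every `g₀, os`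
— n27-c's `ratesAt_keyed₁₁_of_six` with its `h17` supplied by `n17_keyed₁₁_of_readOut_keyed`; `spine_rec11C_of_keyed₁₁` then takes this `hrates` verbatim. [bookkeeping]
[cite: Balaban1987RG1, (1.20)-(1.22) p.264] -/
theorem ratesAt_keyed₁₁_of_five_glueN17
    (h14 : ∀ (F : T4Family) (θ : Stage11Params F N) (hP : θ.Provisos₁₁), θ.Admissible → ∀ (g₀ : ℕ → ℝ) (os : List (ULoop F)), N14At (rr F θ hP g₀ os).ne1)
    (h15 : ∀ (F : T4Family) (θ : Stage11Params F N) (hP : θ.Provisos₁₁), θ.Admissible → ∀ (g₀ : ℕ → ℝ) (os : List (ULoop F)), N15At (rr F θ hP g₀ os).ne2)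
    (h16 : ∀ (F : T4Family) (θ : Stage11Params F N) (hP : θ.Provisos₁₁), θ.Admissible → ∀ (g₀ : ℕ → ℝ) (os : List (ULoop F)), N16At (rr F θ hP g₀ os).ne3)
    (h18 : ∀ (F : T4Family) (θ : Stage11Params F N) (hP : θ.Provisos₁₁), θ.Admissible → ∀ (g₀ : ℕ → ℝ) (os : List (ULoop F)), N18At (rr F θ hP g₀ os).u3)
    (h22 : ∀ (F : T4Family) (θ : Stage11Params F N) (hP : θ.Provisos₁₁), θ.Admissible → ∀ (g₀ : ℕ → ℝ) (os : List (ULoop F)), N22At (rr F θ hP g₀ os).u3)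
    (hD4 : ∀ (F : T4Family) (θ : Stage11Params F N) (hP : θ.Provisos₁₁), θ.Admissible → ∀ (g₀ : ℕ → ℝ) (os : List (ULoop F)),
      ReadOutAt (datumOfRecord₁₁ F N θ hP) (rr F θ hP g₀ os).u3)
    (F : T4Family) (θ : Stage11Params F N) (hP : θ.Provisos₁₁) (hθ : θ.Admissible) (g₀ : ℕ → ℝ) (os : List (ULoop F)) :
    RatesAt (datumOfRecord₁₁ F N θ hP) (rr F θ hP g₀ os) :=
  ⟨h14 F θ hP hθ g₀ os, h15 F θ hP hθ g₀ os, h16 F θ hP hθ g₀ os, n17_keyed₁₁_of_readOut_keyed rr hD4 h18 F θ hP hθ g₀ os,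
    h18 F θ hP hθ g₀ os, h22 F θ hP hθ g₀ os⟩

end KeyedGlue

/-- **THE SAME GLUE AT LAYER B's TOWER KEY**: for a reading `rc` off `(θ, g₀, os, k)` (layer B's `rateCarriersOfRecord₁₁ 𝔯`), the (D4) read-out and NE5 at the bundles of
record of every datum of record ⟹ N17 there (pointwise `YMDAG.N17.n17At_of_readOutAt`); at the home this is `S_D4 (RRec₁₁ 𝔯) → S_N18 (RRec₁₁ 𝔯) → S_N17 (RRec₁₁ 𝔯)` =
companion `…N17AtSpineCarriers`' `YMDAG.N17.s_N17_of_D4_N18` verbatim (not restated). [cite: Balaban1987RG1, (1.20)-(1.22) p.264] -/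
theorem n17_towerKeyed₁₁_of_readOut (rc : (F : T4Family) → Stage11Params F N → (ℕ → ℝ) → List (ULoop F) → ℕ → RateCarriers N)
    (hD4 : ∀ (F : T4Family) (D : Datum F N) (h : IsDatumOfRecord₁₁C F N D) (g₀ : ℕ → ℝ) (os : List (ULoop F)) (k : ℕ),
      ReadOutAt D (rc F h.params g₀ os k).u3)
    (h18 : ∀ (F : T4Family) (D : Datum F N) (h : IsDatumOfRecord₁₁C F N D) (g₀ : ℕ → ℝ) (os : List (ULoop F)) (k : ℕ),
      N18At (rc F h.params g₀ os k).u3)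
    (F : T4Family) (D : Datum F N) (h : IsDatumOfRecord₁₁C F N D) (g₀ : ℕ → ℝ) (os : List (ULoop F)) (k : ℕ) :
    N17At D (rc F h.params g₀ os k).u3 :=
  YMDAG.N17.n17At_of_readOutAt _ (hD4 F D h g₀ os k) (h18 F D h g₀ os k)

end Summit.QuantumFields.YangMills.Theorems.BalabanUVNodesN17

end
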